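import Summits.QuantumFields.YangMills.Theorems.DirichletWindowFixedDistanceLowerPsdTransfer
import HarnessLib

/-!
# `DirichletWindow.LocalGaussianity` (item stmt-QuantumFields-12314 = 8938 ∧ 8939) from three named inputs — «exp-moment tangent law»

Sorry-free REDUCTION (seat ym-idea-4, gen 4, LINE-3).  The landed `EquipartitionPinsProbe.stub_tangent` states (T0) for the JOINT laws of the
scaled raw plaquette costs `X_p = β(N − Re tr r(U_p))` over any finite family of plaquettes against bounded continuous test functions, and
`stub_rigidity` identifies every tangent law as `curvatureGaussianField 4 D` (`X_p ↦ ½|Y_p|²`).  What separates (T0) from the second-order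
quantities of route `DirichletWindow` — `β² f_β(n e₀) = Cov_μ(X_0, X_{n e₀})`, `β² f_β(0) = Var_μ X_0` — is uniform integrability of `X_0 X_n`,
which the chessboard exponential moment `E_μ e^{X_p/2} ≤ C` (input `ExpMomentBound`: FILS chessboard on even tori, the tree's odd-torus reflection
positivity `SoloBlind.wilsonExpectation_exp_plaquetteCost_le`, the free-energy constant term `FreeEnergyLogCoefficient_holds`, thermodynamic limit)
supplies.  Hence `β² f_β(n e₀) → (D/2)·c_n²` uniformly over torus-limit states (input `SecondOrderLocalLaw`; Isserlis), and with
`FixedDistanceLowerPsdTransfer.KernelLower` (`|c_n| ≥ κ'/n⁴` eventually) the composition `localGaussianity_of` gives the route's TARGET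
`LocalGaussianity` BY NAME (`A = D_h κ'²/2`, `B = D_h c_0² + 1`), hence — through the landed door `xiDivergesOfFixedDistance_proof` — `XiDiverges`
(item 8941) modulo the three inputs.  Elementary real arithmetic ([folklore]); no rung or summit statement is proved here.

References: [FILS1978] Fröhlich–Israel–Lieb–Simon, CMP 62 (1978) Thm 4.3; [OsterwalderSeiler1978] Ann. Phys. 110 (1978); S. Chatterjee,
arXiv:1602.01222 §§11–14, arXiv:1803.01950 Problem 5.1; Lawler–Limic 2010 §4.3.
-/

set_option autoImplicit false

open MeasureTheory Filter Topology
open Literature.Probability.LatticeModels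
open Literature.MathematicalPhysics.QuantumFieldTheory
open Literature.MathematicalPhysics.QuantumLattice
open Summit.QuantumFields.YangMills.Theorems.FixedDistanceLowerPsdTransfer (axis kernel01 KernelLower)

namespace Summit.QuantumFields.YangMills.Theorems.LocalGaussianityExpMomentTangentLaw

/-- INPUT 1 — **chessboard exponential moment** of one `(0,1)`-plaquette cost in every torus-limit state at weak coupling:
`E_μ exp(X_p/2) ≤ C`, `X_p = β(N − Re tr r(U_p))`, uniformly in the site. (FILS chessboard on even tori `WilsonPlaquetteTail.integral_plaquette_le_rpow_sites`
with `f = e^{(β/2)φ}`, `SoloBlind.wilsonExpectation_exp_plaquetteCost_le` on odd tori, `⟨e^{(β/2)φ_p}⟩_L ≤ exp(κ_L L⁻⁴(log Z_L(β/2) − log Z_L(β)))`,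
`FreeEnergyLogCoefficient_holds` + `exists_hasFreeEnergyDensity_holds` ⇒ `→ exp(κ (3D/2) log 2)`; bounded continuous cylinder observable ⇒ limit states.) -/
def ExpMomentBound : Prop :=
  ∀ (G : Type) [Group G] [TopologicalSpace G] [IsTopologicalGroup G] [CompactSpace G] [MeasurableSpace G] [BorelSpace G],
    IsCompactSimpleLieGroup G → ∀ r : LatticeRep G, ∃ C β₁ : ℝ, ∀ β : ℝ, β₁ ≤ β →
      ∀ μ ∈ infiniteVolumeLimitPoints (d := 4) r.ρ β, ∀ x : Site 4,
        ∫ U, Real.exp (β / 2 * ((r.N : ℝ) - plaquetteObs r.ρ x 0 1 U)) ∂μ ≤ C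

/-- INPUT 2 — **second-order local free-gluon law on the axis**: `β² f_β(n e₀) → D_h · c_n²` uniformly over torus-limit states, for every
`n ≥ 0`, with `D_h = (dim 𝔤_r)/2 > 0` and `c_n = kernel01 n`.  (From INPUT 1: UI of `X_0 X_{n e₀}`; `EquipartitionPinsProbe.stub_tangent` (T0) for the pair
`((0;0,1), (n e₀;0,1))` + `stub_rigidity` + the compactness wrapper of `stub_localLaw`; mean equipartition from `FreeEnergyLogCoefficient_holds`;
Isserlis under `curvatureGaussianField`.) -/
def SecondOrderLocalLaw : Prop :=
  ∀ (G : Type) [Group G] [TopologicalSpace G] [IsTopologicalGroup G] [CompactSpace G] [MeasurableSpace G] [BorelSpace G],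
    IsCompactSimpleLieGroup G → ∀ r : LatticeRep G, ∃ Dh : ℝ, 0 < Dh ∧ ∀ (n : ℕ) (ε : ℝ), 0 < ε → ∃ β₁ : ℝ, ∀ β : ℝ, β₁ ≤ β →
      ∀ μ ∈ infiniteVolumeLimitPoints (d := 4) r.ρ β,
        |β ^ 2 * plaquetteCorrFn r.ρ μ (axis n) - Dh * kernel01 n ^ 2| < ε

/-- **Composition (kernel-checked):** the three inputs give DW's target `LocalGaussianity = FixedDistanceLower ∧ PlaquetteVarianceUpper` BY NAME
(`A = D_h κ'²/2`, `B = D_h c_0² + 1`). -/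
theorem localGaussianity_of (h1 : ExpMomentBound) (h2 : ExpMomentBound → SecondOrderLocalLaw) (h3 : KernelLower) :
    Summit.QuantumFields.YangMills.Theses.DirichletWindow.LocalGaussianity := by
  constructor
  · -- `FixedDistanceLower` (item 8938)
    intro G _ _ _ _ _ _ hG r
    obtain ⟨Dh, hDh, hlaw⟩ := h2 h1 G hG r
    obtain ⟨κ', hκ', n₀, hn₀, hker⟩ := h3
    refine ⟨Dh * κ' ^ 2 / 2, n₀, by positivity, fun n hn => ?_⟩
    have hn1 : (1 : ℝ) ≤ n := by exact_mod_cast le_trans hn₀ hn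
    have hn8 : (0 : ℝ) < (n : ℝ) ^ 8 := by positivity
    have hc : κ' / (n : ℝ) ^ 4 ≤ |kernel01 n| := hker n hn
    have hc2 : κ' ^ 2 ≤ kernel01 n ^ 2 * (n : ℝ) ^ 8 := by
      have h0 : 0 ≤ κ' / (n : ℝ) ^ 4 := by positivity
      have h1 : (κ' / (n : ℝ) ^ 4) ^ 2 ≤ |kernel01 n| ^ 2 := pow_le_pow_left₀ h0 hc 2
      rw [sq_abs, div_pow, ← pow_mul] at h1
      norm_num at h1
      rwa [div_le_iff₀ hn8] at h1
    have hcpos : 0 < kernel01 n ^ 2 := by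
      by_contra h
      nlinarith [sq_nonneg κ', hκ', not_lt.1 h]
    obtain ⟨β₁, hβ₁⟩ := hlaw n (Dh * kernel01 n ^ 2 / 2) (by positivity)
    refine ⟨max β₁ 1, fun β hβ μ hμ => ?_⟩
    have hβ1 : 1 ≤ β := le_trans (le_max_right _ _) hβ
    have key := (abs_lt.1 (hβ₁ β (le_trans (le_max_left _ _) hβ) μ hμ)).1
    show Dh * κ' ^ 2 / 2 / (β ^ 2 * (n : ℝ) ^ 8) ≤ plaquetteCorrFn r.ρ μ (axis n)
    rw [div_le_iff₀ (by positivity)]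
    have h3 : Dh * kernel01 n ^ 2 / 2 < β ^ 2 * plaquetteCorrFn r.ρ μ (axis n) := by linarith
    have h4 : Dh * κ' ^ 2 ≤ Dh * (kernel01 n ^ 2 * (n : ℝ) ^ 8) := mul_le_mul_of_nonneg_left hc2 hDh.le
    nlinarith [mul_le_mul_of_nonneg_right h3.le hn8.le]
  · -- `PlaquetteVarianceUpper` (item 8939)
    intro G _ _ _ _ _ _ hG r
    obtain ⟨Dh, hDh, hlaw⟩ := h2 h1 G hG r
    obtain ⟨β₁, hβ₁⟩ := hlaw 0 1 one_pos
    refine ⟨Dh * kernel01 0 ^ 2 + 1, max β₁ 1, fun β hβ μ hμ => ?_⟩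
    have hβ1 : 1 ≤ β := le_trans (le_max_right _ _) hβ
    have key := (abs_lt.1 (hβ₁ β (le_trans (le_max_left _ _) hβ) μ hμ)).2
    have h0 : axis 0 = 0 := by simp [axis]
    rw [h0] at key
    rw [le_div_iff₀ (by positivity)]
    linarith

end Summit.QuantumFields.YangMills.Theorems.LocalGaussianityExpMomentTangentLaw
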